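import Literature.AlgebraicGeometry.Motives.AbelianVarietyWeilDivisor
import Literature.AlgebraicGeometry.Motives.CartierDivisorClassPullback
import HarnessLib

/-!
# Lange's Cor. 4.4.5 for ALL points from a dense open: `aj(f^♮ D_x^Θ) = x⁻¹` on a non-empty open + multiplicativity ⟹ everywhere

Layer `Literature/AlgebraicGeometry/Motives`, namespace `Literature.AlgebraicGeometry.Motives.AbelianVariety`.  KERNEL ONLY: one theorem; no
definition, no named fact, no instance, no `sorry`.  The assembled leaf (g4-3) of road G4 (cell `hodgecm-mathlib`, director ruling s225;
letters `A-provers/A-p04/g17/G4.sockets.v3.A-p04g17.lean` §3, pen ruling #1 (R1) «no seesaw»): Lange's Step II of Lemma 4.4.4 (the seesaw on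
`C × J`) is replaced by a group-theoretic closure.

For an abelian variety `A` over `ℂ`, a morphism `f : Z → A` from an integral scheme, a divisor `Θ`, and ANY map
`aj : CartierDivisor Z → A(ℂ)` (an «Abel–Jacobi sum»; `f^♮` = ★ `CartierDivisor.classPullback`, `D^Θ_x = t_x^*Θ − Θ` = ★ `weilDiv`):
IF `x ↦ aj(f^♮ D^Θ_x)` is multiplicative ((3b): theorem of the square + class additivity + Abel), IF `aj(f^♮ D^Θ_x) = x⁻¹` for all `x`
whose underlying point lies in a non-empty open `U ⊆ A` ((3a) = [Lange2023AbelianVarietiesComplex] Lem. 4.4.4 Step I =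
[Milne1986JacobianVarieties] Lem. 6.7), and IF every subgroup of `A(ℂ)` containing those points is everything ((3c): `A` irreducible,
`U·U = A`), THEN **`aj(f^♮ D^Θ_x) = x⁻¹` for EVERY `x ∈ A(ℂ)`** — the set where it holds is a subgroup.  [Lange2023AbelianVarietiesComplex
§4.4.2 Cor. 4.4.5 «`(α_c^*)⁻¹ = −φ_Θ`»; Milne1986JacobianVarieties §6 Lem. 6.8–6.9.]  COUNT-NEUTRAL.  HC_CM is proved only modulo the 7
printed citations until rung 0 closes; this file moves no book by itself.
-/

set_option autoImplicit false

noncomputable section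

open CategoryTheory AlgebraicGeometry

universe u

namespace Literature.AlgebraicGeometry.Motives

namespace AbelianVariety

/-- **Cor. 4.4.5 for all points from a dense open** (see the module docstring): multiplicativity of `x ↦ aj(f^♮ D^Θ_x)`, the identity
`aj(f^♮ D^Θ_x) = x⁻¹` on the complex points of a non-empty open `U`, and «subgroups containing `U(ℂ)` are everything» give the identity for
every `x`. [cite: Lange2023AbelianVarietiesComplex, §4.4.2 Lemma 4.4.4 and Cor. 4.4.5] [cite: Milne1986JacobianVarieties, §6 Lemma 6.8 and Lemma 6.9] -/
theorem aj_classPullback_weilDiv_eq_inv_of_open {A : AbelianVariety ℂ} {Z : Scheme.{0}} [IsIntegral Z] (f : Z ⟶ A.X.left)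
    (Θ : CartierDivisor A.X.left) (aj : CartierDivisor Z → A.Points ℂ)
    (hmul : ∀ x y : A.Points ℂ, aj ((A.weilDiv Θ (x * y)).classPullback f) =
      aj ((A.weilDiv Θ x).classPullback f) * aj ((A.weilDiv Θ y).classPullback f))
    (U : A.X.left.Opens) (hU : ∀ x : A.Points ℂ, x.pt ∈ U → aj ((A.weilDiv Θ x).classPullback f) = x⁻¹)
    (hdense : ∀ H : Subgroup (A.Points ℂ), (∀ x : A.Points ℂ, x.pt ∈ U → x ∈ H) → H = ⊤)
    (x : A.Points ℂ) : aj ((A.weilDiv Θ x).classPullback f) = x⁻¹ := by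
  -- the multiplicative map `φ x := aj(f^♮ D_x) · x`; the identity says `φ x = 1`
  set φ : A.Points ℂ → A.Points ℂ := fun x => aj ((A.weilDiv Θ x).classPullback f) * x with hφ
  have hφmul : ∀ x y, φ (x * y) = φ x * φ y := fun x y => by
    simp only [hφ, hmul]
    rw [mul_mul_mul_comm]
  let Φ : A.Points ℂ →* A.Points ℂ := MonoidHom.mk' φ hφmul
  -- its kernel contains the points of `U`, hence is everything
  have hker : Φ.ker = ⊤ := hdense Φ.ker fun x hx => by
    rw [MonoidHom.mem_ker]
    change aj ((A.weilDiv Θ x).classPullback f) * x = 1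
    rw [hU x hx, inv_mul_cancel]
  have hx : x ∈ Φ.ker := by rw [hker]; exact Subgroup.mem_top x
  rw [MonoidHom.mem_ker] at hx
  change aj ((A.weilDiv Θ x).classPullback f) * x = 1 at hx
  exact eq_inv_of_mul_eq_one_left hx

end AbelianVariety

end Literature.AlgebraicGeometry.Motives

end
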